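import Summits.CriticalPhenomena.PercolationContinuityZ3.Theorems.Transplant.SkelPhiQStepsReach
import HarnessLib

/-!
# N1 (the `{±1}` node), LEVEL 1, kit adapter file N-K1′: QUASI-STEPS OF ANY BOUNDED COST — `Skelφ.LinkN G F N w w′` (a `G`-walk of length `≤ N`
# whose support is at `F w` or equals `w′`) and `Skelφ.QStepsN G F N` (every unit move of `F` through a `LinkN`), with the reach machinery of
# `SkelPhiQStepsReach` (N-K1, the case `N = 3` = hp-8's `QSteps`/`Link3`) re-typed for general `N`

builds on p205010 (kernel theorem, internal audit signed; external expert review pending) — nothing in this file uses p205010; nothing here is a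
claim about the open node `SamePDropOfSkeletonNeg`.
Lane `prim-bschramm`, seat `prim-bschramm-p1` (gen 11); helper file (`--supports stmt-CriticalPhenomena-4575 --as helper`).
WHY.  Under the κ-ruling (design owner 2026-08-21 13:56:36Z, lead 13:56:39Z: LEVEL 0 delivers `|h_L| ≤ k·n_L`) the run frames `runX/runY` keep
their raw axis `α`; their unit moves are realised by walks of length `≤ k + 3` (pre-correcting `β`-steps at fixed frame value, then one `α`-step;
`≤ k + 2` `β`-steps inward) with the EXACT inner footprint — quasi-steps of cost `N = k + 3`, not `3`.  Everything of N-K1 goes through with `3 ↦ N`.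
* §1 `LinkN`, `QStepsN`, `LinkN.mono`, `QStepsN.mono`, `LinkN.mem_graphBall`, `linkN_of_link3`, **`qStepsN_of_qSteps`** (`QSteps ⇒ QStepsN 3`),
  **`qStepsN_of_steps`** (`Steps ⇒ QStepsN 1`);
* §2 `qstepQ` + `qstepQ_spec`; **`walkQ G F N i s v k`**, `walkQ_link`, **`F_walkQ`**, **`walkQ_mem_graphBall`** (`B_G(v, N k)`); `linkFinQ` + `left/right_mem_linkFinQ`,
  `F_of_mem_linkFinQ'`, `linkFinQ_subset_graphBall`, `card_linkFinQ_le` (`≤ N + 1`), `pathIn_of_linkFinQ_subset`;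
* §3 **`QStepsN.exists_mem_graphBall_eq`** (reach `z` within `N‖z − F v‖₁`), `colPtQ` + `colPtQ_spec`.
[cite: KozmaNitzan2024, §4 Lemma 10 Step III (p. 19), p. 21, p. 26 ((29))] [cite: MartineauTassion2017, §4.3]
-/

noncomputable section

namespace Summit.CriticalPhenomena.PercolationContinuityZ3.Theorems.Transplant

namespace Skelφ

open scoped Classical

open Literature.Probability.Percolation Literature.Probability.LatticeModels SimpleGraph
open Literature.Barriers.CriticalPhenomena (graphBall mem_graphBall_self graphBall_mono)

variable {V : Type} {G : SimpleGraph V} {F : V → Site 2}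

/-! ## §1 Links and quasi-steps of bounded cost -/

variable (G) in
/-- **A link of cost `≤ N`**: a `G`-walk from `w` to `w′` of length `≤ N` all of whose vertices are at the start value of `F` or equal to the far
end (the EXACT inner footprint). `Link3` is the case `N = 3`. [this work] -/
def LinkN (F : V → Site 2) (N : ℕ) (w w' : V) : Prop :=
  ∃ p : G.Walk w w', p.length ≤ N ∧ ∀ u ∈ p.support, F u = F w ∨ u = w'

variable (G) in
/-- **Quasi-steps of cost `N`**: every unit move of the planar map in each of the four directions is realised by a `LinkN`. [this work] -/
def QStepsN (F : V → Site 2) (N : ℕ) : Prop :=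
  ∀ (w : V) (i : Fin 2) (σ : ℤˣ), ∃ w', F w' = F w + Pi.single i (σ : ℤ) ∧ LinkN G F N w w'

/-- Links with a larger cost bound. [folklore] -/
theorem LinkN.mono {N N' : ℕ} {w w' : V} (h : LinkN G F N w w') (hN : N ≤ N') : LinkN G F N' w w' := by
  obtain ⟨p, hp, hF⟩ := h
  exact ⟨p, hp.trans hN, hF⟩

/-- Quasi-steps with a larger cost bound. [folklore] -/
theorem QStepsN.mono {N N' : ℕ} (h : QStepsN G F N) (hN : N ≤ N') : QStepsN G F N' := fun w i σ => by
  obtain ⟨w', hw', hl⟩ := h w i σ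
  exact ⟨w', hw', hl.mono hN⟩

/-- The far end of a link lies in the graph ball of radius `N`. [folklore] -/
theorem LinkN.mem_graphBall {N : ℕ} {w w' : V} (h : LinkN G F N w w') : w' ∈ graphBall G w N := by
  obtain ⟨p, hp, -⟩ := h
  exact ⟨p, hp⟩

/-- A `Link3` is a link of cost `≤ 3`. [folklore] -/
theorem linkN_of_link3 {w w' : V} (h : Link3 G F w w') : LinkN G F 3 w w' := h.exists_walk

/-- **hp-8's quasi-steps are quasi-steps of cost `3`.** [folklore] -/
theorem qStepsN_of_qSteps (hq : QSteps G F) : QStepsN G F 3 := fun w i σ => by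
  obtain ⟨w', hw', hl⟩ := hq w i σ
  exact ⟨w', hw', linkN_of_link3 hl⟩

/-- **Unit steps are quasi-steps of cost `1`.** [folklore] -/
theorem qStepsN_of_steps {φ : V → Site 2} (hstep : Steps G φ) : QStepsN G φ 1 := fun w i σ => by
  obtain ⟨w', hadj, hφ⟩ := hstep w i σ
  refine ⟨w', hφ, Walk.cons hadj Walk.nil, by simp, fun u hu => ?_⟩
  rw [Walk.support_cons, Walk.support_nil, List.mem_cons, List.mem_singleton] at hu
  rcases hu with rfl | rfl
  · exact Or.inl rfl
  · exact Or.inr rfl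

/-! ## §2 Chosen quasi-steps, straight quasi-walks and their link sets -/

variable (G F) in
/-- **A chosen quasi-step of cost `N`** from `v` along `s e_i`: a vertex `v′` with `F v′ = F v + s e_i` linked to `v` at cost `≤ N`, when there is
one (always, under `QStepsN`), else `v`. [this work] -/
def qstepQ (N : ℕ) (i : Fin 2) (s : ℤˣ) (v : V) : V :=
  if h : ∃ v' : V, F v' = F v + Pi.single i (s : ℤ) ∧ LinkN G F N v v' then Classical.choose h else v

/-- Specification of the chosen quasi-step (under `QStepsN`). [folklore] -/
theorem qstepQ_spec {N : ℕ} (hq : QStepsN G F N) (i : Fin 2) (s : ℤˣ) (v : V) :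
    F (qstepQ G F N i s v) = F v + Pi.single i (s : ℤ) ∧ LinkN G F N v (qstepQ G F N i s v) := by
  have h : ∃ v' : V, F v' = F v + Pi.single i (s : ℤ) ∧ LinkN G F N v v' := hq v i s
  unfold qstepQ
  rw [dif_pos h]
  exact Classical.choose_spec h

variable (G F) in
/-- **The straight quasi-walk of cost `N`** from `v` along `s e_i`: `p₀ = v`, `p_{k+1} = qstepQ (p_k)`. [cite: KozmaNitzan2024, §4 p. 21] -/
def walkQ (N : ℕ) (i : Fin 2) (s : ℤˣ) (v : V) : ℕ → V
  | 0 => v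
  | k + 1 => qstepQ G F N i s (walkQ N i s v k)

/-- `p₀ = v`. [folklore] -/
@[simp] theorem walkQ_zero (N : ℕ) (i : Fin 2) (s : ℤˣ) (v : V) : walkQ G F N i s v 0 = v := rfl

/-- `p_{k+1} = qstepQ p_k`. [folklore] -/
theorem walkQ_succ (N : ℕ) (i : Fin 2) (s : ℤˣ) (v : V) (k : ℕ) : walkQ G F N i s v (k + 1) = qstepQ G F N i s (walkQ G F N i s v k) := rfl

/-- Consecutive quasi-walk vertices are linked and `F` moves by `s e_i` (under `QStepsN`). [folklore] -/
theorem walkQ_succ_spec {N : ℕ} (hq : QStepsN G F N) (i : Fin 2) (s : ℤˣ) (v : V) (k : ℕ) :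
    LinkN G F N (walkQ G F N i s v k) (walkQ G F N i s v (k + 1)) ∧
      F (walkQ G F N i s v (k + 1)) = F (walkQ G F N i s v k) + Pi.single i (s : ℤ) := by
  rw [walkQ_succ]
  exact ⟨(qstepQ_spec hq i s _).2, (qstepQ_spec hq i s _).1⟩

/-- Consecutive quasi-walk vertices are linked. [folklore] -/
theorem walkQ_link {N : ℕ} (hq : QStepsN G F N) (i : Fin 2) (s : ℤˣ) (v : V) (k : ℕ) :
    LinkN G F N (walkQ G F N i s v k) (walkQ G F N i s v (k + 1)) :=
  (walkQ_succ_spec hq i s v k).1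

/-- **Planar coordinates along the quasi-walk**: `F p_k = F v + k s e_i`. [folklore] -/
theorem F_walkQ {N : ℕ} (hq : QStepsN G F N) (i : Fin 2) (s : ℤˣ) (v : V) (k : ℕ) :
    F (walkQ G F N i s v k) = F v + Pi.single i ((k : ℤ) * (s : ℤ)) := by
  induction k with
  | zero => simp
  | succ k ih =>
    rw [(walkQ_succ_spec hq i s v k).2, ih, add_assoc, ← Pi.single_add]
    congr 2; push_cast; ring

/-- **The quasi-walk stays in the graph ball**: `p_k ∈ B_G(v, N k)`. [folklore] -/
theorem walkQ_mem_graphBall {N : ℕ} (hq : QStepsN G F N) (i : Fin 2) (s : ℤˣ) (v : V) (k : ℕ) : walkQ G F N i s v k ∈ graphBall G v (N * k) := by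
  induction k with
  | zero => exact mem_graphBall_self G v 0
  | succ k ih =>
    have h := BoxProdZ2.mem_graphBall_add G ih (walkQ_link hq i s v k).mem_graphBall
    exact graphBall_mono G v (by rw [Nat.mul_succ]) h

variable (G F) in
/-- **The vertices of a chosen link of cost `N`** `w — ⋯ — w′` (a walk of length `≤ N` with every vertex at `F w` or equal to `w′`), when there
is one (always, for a `LinkN`), else `{w}`. [this work] -/
def linkFinQ [DecidableEq V] (N : ℕ) (w w' : V) : Finset V :=
  if h : ∃ p : G.Walk w w', p.length ≤ N ∧ ∀ u ∈ p.support, F u = F w ∨ u = w' then (Classical.choose h).support.toFinset else {w}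

section LinkFin

variable [DecidableEq V]

/-- Under a link, `linkFinQ` is the support of a chosen short walk with the footprint property. [folklore] -/
theorem linkFinQ_spec {N : ℕ} {w w' : V} (h : LinkN G F N w w') :
    ∃ p : G.Walk w w', p.length ≤ N ∧ (∀ u ∈ p.support, F u = F w ∨ u = w') ∧ linkFinQ G F N w w' = p.support.toFinset := by
  have h' : ∃ p : G.Walk w w', p.length ≤ N ∧ ∀ u ∈ p.support, F u = F w ∨ u = w' := h
  refine ⟨Classical.choose h', (Classical.choose_spec h').1, (Classical.choose_spec h').2, ?_⟩
  unfold linkFinQ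
  rw [dif_pos h']

/-- The start belongs to the link set. [folklore] -/
theorem left_mem_linkFinQ (N : ℕ) (w w' : V) : w ∈ linkFinQ G F N w w' := by
  unfold linkFinQ
  split_ifs with h
  · exact List.mem_toFinset.2 (Walk.start_mem_support _)
  · exact Finset.mem_singleton_self w

/-- Under a link, the far end belongs to the link set. [folklore] -/
theorem right_mem_linkFinQ {N : ℕ} {w w' : V} (h : LinkN G F N w w') : w' ∈ linkFinQ G F N w w' := by
  obtain ⟨p, -, -, hp⟩ := linkFinQ_spec h
  rw [hp]
  exact List.mem_toFinset.2 (Walk.end_mem_support _)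

/-- **Footprint of a link set**: every vertex is at `F w` or is the far end (under a link). [folklore] -/
theorem F_of_mem_linkFinQ {N : ℕ} {w w' : V} (h : LinkN G F N w w') {u : V} (hu : u ∈ linkFinQ G F N w w') : F u = F w ∨ u = w' := by
  obtain ⟨p, -, hF, hp⟩ := linkFinQ_spec h
  rw [hp, List.mem_toFinset] at hu
  exact hF u hu

/-- Without the link hypothesis the footprint still holds in the weak form `F u = F w ∨ u = w′`. [folklore] -/
theorem F_of_mem_linkFinQ' {N : ℕ} {w w' u : V} (hu : u ∈ linkFinQ G F N w w') : F u = F w ∨ u = w' := by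
  unfold linkFinQ at hu
  split_ifs at hu with h
  · exact (Classical.choose_spec h).2 u (List.mem_toFinset.1 hu)
  · rw [Finset.mem_singleton] at hu; subst hu; exact Or.inl rfl

/-- The link set lies in `B_G(w, N)`. [folklore] -/
theorem linkFinQ_subset_graphBall (N : ℕ) (w w' : V) : ∀ u ∈ linkFinQ G F N w w', u ∈ graphBall G w N := by
  intro u hu
  unfold linkFinQ at hu
  split_ifs at hu with h
  · rw [List.mem_toFinset] at hu
    obtain ⟨hl, -⟩ := Classical.choose_spec h
    exact ⟨(Classical.choose h).takeUntil u hu, ((Classical.choose h).length_takeUntil_le_length hu).trans hl⟩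
  · rw [Finset.mem_singleton] at hu; subst hu; exact mem_graphBall_self G _ N

/-- The link set has at most `N + 1` vertices. [folklore] -/
theorem card_linkFinQ_le (N : ℕ) (w w' : V) : (linkFinQ G F N w w').card ≤ N + 1 := by
  unfold linkFinQ
  split_ifs with h
  · obtain ⟨hl, -⟩ := Classical.choose_spec h
    refine (List.toFinset_card_le _).trans ?_
    rw [Walk.length_support]; omega
  · simp

/-- **The link set joins its ends inside any set containing it** (`A ⊇ linkFinQ w w′`). [folklore] -/
theorem pathIn_of_linkFinQ_subset {N : ℕ} {A : Set V} {w w' : V} (hA : ∀ u ∈ linkFinQ G F N w w', u ∈ A) :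
    ∀ u ∈ linkFinQ G F N w w', PathIn G A w u := by
  intro u hu
  unfold linkFinQ at hu hA
  split_ifs at hu hA with h
  · rw [List.mem_toFinset] at hu
    exact pathIn_of_walk_support_subset (Classical.choose h) (fun v hv => hA v (List.mem_toFinset.2 hv)) u hu
  · rw [Finset.mem_singleton] at hu; subst hu
    exact PathIn.refl (hA _ (Finset.mem_singleton_self _))

end LinkFin

/-! ## §3 Reaching planar points: the column vertex -/

/-- **Under `QStepsN`, every planar point `z` is the image of a vertex within graph distance `N‖z − F v‖₁` of `v`** (two straight quasi-walks).
[cite: KozmaNitzan2024, §4 p. 26 ((29))] -/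
theorem QStepsN.exists_mem_graphBall_eq {N : ℕ} (hq : QStepsN G F N) (v : V) (z : Site 2) :
    ∃ g, g ∈ graphBall G v (N * ((z 0 - F v 0).natAbs + (z 1 - F v 1).natAbs)) ∧ F g = z := by
  -- signs and lengths of the two legs
  obtain ⟨s₀, hs₀⟩ : ∃ s : ℤˣ, ((z 0 - F v 0).natAbs : ℤ) * (s : ℤ) = z 0 - F v 0 := by
    rcases le_or_gt 0 (z 0 - F v 0) with h | h
    · exact ⟨1, by rw [Units.val_one, mul_one]; exact Int.natAbs_of_nonneg h⟩
    · exact ⟨-1, by rw [Units.val_neg, Units.val_one, mul_neg, mul_one, Int.ofNat_natAbs_of_nonpos h.le]; ring⟩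
  set g₁ := walkQ G F N 0 s₀ v (z 0 - F v 0).natAbs with hg₁
  have hF₁ : F g₁ = F v + Pi.single 0 (z 0 - F v 0) := by rw [hg₁, F_walkQ hq, hs₀]
  have hF₁0 : F g₁ 0 = z 0 := by rw [hF₁]; simp
  have hF₁1 : F g₁ 1 = F v 1 := by rw [hF₁]; simp
  obtain ⟨s₁, hs₁⟩ : ∃ s : ℤˣ, ((z 1 - F v 1).natAbs : ℤ) * (s : ℤ) = z 1 - F v 1 := by
    rcases le_or_gt 0 (z 1 - F v 1) with h | h
    · exact ⟨1, by rw [Units.val_one, mul_one]; exact Int.natAbs_of_nonneg h⟩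
    · exact ⟨-1, by rw [Units.val_neg, Units.val_one, mul_neg, mul_one, Int.ofNat_natAbs_of_nonpos h.le]; ring⟩
  set g := walkQ G F N 1 s₁ g₁ (z 1 - F v 1).natAbs with hg
  have hF : F g = F g₁ + Pi.single 1 (z 1 - F v 1) := by rw [hg, F_walkQ hq, hs₁]
  refine ⟨g, ?_, ?_⟩
  · have h1 := walkQ_mem_graphBall hq 0 s₀ v (z 0 - F v 0).natAbs
    have h2 := walkQ_mem_graphBall hq 1 s₁ g₁ (z 1 - F v 1).natAbs
    exact graphBall_mono G v (by rw [Nat.mul_add]) (BoxProdZ2.mem_graphBall_add G h1 h2)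
  · funext j
    fin_cases j
    · show F g 0 = z 0
      rw [hF, Pi.add_apply, Pi.single_eq_of_ne (by decide), add_zero, hF₁0]
    · show F g 1 = z 1
      rw [hF, Pi.add_apply, Pi.single_eq_same, hF₁1]; ring

variable (G F) in
/-- **The column vertex (cost `N`)** over the planar point `z` seen from `v`: a vertex `g` with `F g = z` within graph distance `N‖z − F v‖₁`, when
there is one (always, under `QStepsN`), else `v`. [folklore] -/
def colPtQ (N : ℕ) (v : V) (z : Site 2) : V :=
  if h : ∃ g, g ∈ graphBall G v (N * ((z 0 - F v 0).natAbs + (z 1 - F v 1).natAbs)) ∧ F g = z then Classical.choose h else v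

/-- Specification of the column vertex (under `QStepsN`). [folklore] -/
theorem colPtQ_spec {N : ℕ} (hq : QStepsN G F N) (v : V) (z : Site 2) :
    colPtQ G F N v z ∈ graphBall G v (N * ((z 0 - F v 0).natAbs + (z 1 - F v 1).natAbs)) ∧ F (colPtQ G F N v z) = z := by
  have h := hq.exists_mem_graphBall_eq v z
  unfold colPtQ
  rw [dif_pos h]
  exact Classical.choose_spec h

end Skelφ

end Summit.CriticalPhenomena.PercolationContinuityZ3.Theorems.Transplant

end
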